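import Mathlib

/-!
# C-025 at q = 3: the four census cells of the lifted rule R₃⁺ where the pure form is too weak (night-3)

The per-plane modules `RLSPlanesT{t}_{k}` prove the PURE-FORM R₃⁺ inequality (every 𝒯₀ subset at the share `ρ₃/C(b+x,3)`) for every
simple plane with ≤ 8 points and every `p ≥ 8`, except at four cells where only the TRUE shares `ρ₃/(C(b+x,3) − c)` (`c` = collinear
triples of the subset) carry the inequality: the K₄-plane (6 points, four 3-point lines) at type `t = 2`, `p = 8`, and the plane «two
3-point lines on 5 points» at type `t = 1`, `p = 8, 9, 10`.  Here they are as exact finite sums (witness levels `1 ≤ x ≤ p − 4`, outside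
points `p − t`), evaluated by `norm_num`.  Reading of the K₄-plane at `t = 2`, `p = 8` (six outside points): 16 triples (share `1/C(x+3,3)`),
12 lined 4-sets (`3/(C(x+4,3) − 1)`), 3 generic 4-sets (`4/C(x+4,3)`), 6 five-sets with two 3-lines (`8/(C(x+5,3) − 2)`), the plane itself
(hard max, share 1); demand `#{B' : |G ∖ B'| ≥ 2} = 31`; `Φ(8,3) = 48/5`.
-/

namespace PercRepro.NightThree.Cells

open Finset

/-- Witness level `x ↦ C(6, x) · (true R₃⁺ share sum of the K₄-plane at t = 2, p = 8)`. -/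
def k4_term (x : ℕ) : ℚ :=
  (Nat.choose 6 x : ℚ) * (16 / ((x + 3).choose 3 : ℚ) + 12 * (3 / (((x + 4).choose 3 : ℚ) - 1)) + 3 * (4 / ((x + 4).choose 3 : ℚ))
    + 6 * (8 / (((x + 5).choose 3 : ℚ) - 2)) + 1)

/-- **The K₄-plane at `t = 2`, `p = 8`** (the one t = 2 cell outside the pure form): `Φ(8,3) · 31 ≤ Σ_{x=1}^{4} k4_term x`. -/
theorem k4_t2_p8 : (48 / 5 : ℚ) * 31 ≤ ∑ x ∈ Icc 1 4, k4_term x := by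
  simp only [k4_term]
  rw [show Icc 1 4 = {1, 2, 3, 4} from rfl]
  norm_num [Nat.choose]

/-- Witness level `x ↦ C(p − 1, x) · (true R₃⁺ share sum of the plane «two 3-lines on 5 points» at t = 1)`:
8 triples (`1/C(x+3,3)`), 4 lined 4-sets (`3/(C(x+4,3) − 1)`), 1 generic 4-set (`4/C(x+4,3)`), the plane (`8/(C(x+5,3) − 2)`). -/
def two3_term (p x : ℕ) : ℚ :=
  (Nat.choose (p - 1) x : ℚ) * (8 / ((x + 3).choose 3 : ℚ) + 4 * (3 / (((x + 4).choose 3 : ℚ) - 1)) + 4 / ((x + 4).choose 3 : ℚ)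
    + 8 / (((x + 5).choose 3 : ℚ) - 2))

/-- **Two 3-lines on 5 points at `t = 1`, `p = 8`**: `Φ(8,3) · 13 ≤ Σ_{x=1}^{4} two3_term 8 x`. -/
theorem two3_t1_p8 : (48 / 5 : ℚ) * 13 ≤ ∑ x ∈ Icc 1 4, two3_term 8 x := by
  simp only [two3_term]
  rw [show Icc 1 4 = {1, 2, 3, 4} from rfl]
  norm_num [Nat.choose]

/-- **Two 3-lines on 5 points at `t = 1`, `p = 9`**: `Φ(9,3) · 13 ≤ Σ_{x=1}^{5} two3_term 9 x` (`Φ(9,3) = 159/10`). -/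
theorem two3_t1_p9 : (159 / 10 : ℚ) * 13 ≤ ∑ x ∈ Icc 1 5, two3_term 9 x := by
  simp only [two3_term]
  rw [show Icc 1 5 = {1, 2, 3, 4, 5} from rfl]
  norm_num [Nat.choose]

/-- **Two 3-lines on 5 points at `t = 1`, `p = 10`**: `Φ(10,3) · 13 ≤ Σ_{x=1}^{6} two3_term 10 x` (`Φ(10,3) = 26`). -/
theorem two3_t1_p10 : (26 : ℚ) * 13 ≤ ∑ x ∈ Icc 1 6, two3_term 10 x := by
  simp only [two3_term]
  rw [show Icc 1 6 = {1, 2, 3, 4, 5, 6} from rfl]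
  norm_num [Nat.choose]

end PercRepro.NightThree.Cells
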